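import Literature.NumberTheory.EllipticCurves.EisensteinSeriesNebentypusLattice
import Literature.NumberTheory.EllipticCurves.EisensteinSeriesNebentypus
import Mathlib.NumberTheory.LSeries.Nonvanishing
import HarnessLib

/-!
# The `q`-expansion of the Eisenstein series with nebentypus `E_k^{ψ̄} = ∑_u ψ(u) E_{k,(0,u)}`
# on `Γ₀(N)` (weights `k ≥ 3`, `ψ` primitive)

Topic `Literature/NumberTheory/EllipticCurves`; namespace
`Literature.NumberTheory.EllipticCurves.ModularForms`.  THEOREMS ONLY (no definition, no named
fact).  Companion of `EisensteinSeriesNebentypus` (the modular form `eisensteinCharMF N k χ`,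
`E_k^χ = ∑_{u ∈ (ℤ/Nℤ)ˣ} χ(u)⁻¹ E_{k,(0,u)}`, with its nebentypus law and value `1 + χ(-1)(-1)^k` at
`i∞`, whose module docstring lists "`q`-expansions of `E_k^χ`" as deliberately not there) and of
`EisensteinSeriesNebentypusLattice` (the `q`-expansion of the lattice sum
`G_ψ = ∑_{(c,d) ∈ ℤ²} ψ(d)(Ncz + d)^{-k}`).

* `eisLatticeChar_eq_LFunction_mul_tsum_coprime` — `G_ψ = L(k, ψ) · ∑_{(c,d) coprime} ψ(d)(Ncz+d)^{-k}`
  (decomposition of `ℤ²` by the gcd, Mathlib `gammaSetDivGcdSigmaEquiv`, as in Mathlib's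
  level-one `tsum_eisSummand_eq_riemannZeta_mul_eisensteinSeries`);
* `tsum_coprime_eq_eisensteinChar` — `∑_{(c,d) coprime} ψ(d)(Ncz+d)^{-k} = E_k^{ψ̄}(z)`
  (`= eisensteinChar N k ψ⁻¹ z`): the pairs with `d` a non-unit mod `N` contribute `0`, and
  `(c, d) ↦ (Nc, d)` is a bijection from the coprime pairs with `d ≡ u` onto Mathlib's
  `gammaSet N 1 (0, u)`;
* `eisLatticeChar_eq_LFunction_mul_eisensteinChar` — **`G_ψ = L(k, ψ) E_k^{ψ̄}`**
  (Diamond–Shurman §4.5–4.6: `G_k^{v̄}` versus the normalised `E_k^{v̄}`/`E_k^{ψ,φ}`);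
* `eisensteinChar_eq_qExpansion` — for `ψ` PRIMITIVE with `ψ(-1) = (-1)^k`:
  **`E_k^{ψ̄}(z) = 2 + (2(-2πi)^k W(ψ) / (N^k (k-1)! L(k,ψ))) ∑_{n ≥ 1} σ_{k-1}^{ψ̄}(n) qⁿ`**,
  `σ_{k-1}^{ψ̄}(n) = ∑_{d ∣ n} ψ̄(d) d^{k-1}`, `W(ψ)` the Gauss sum — Billerey–Menares 2018 (7.1.13)
  (`G_k^{𝟙,χ}(𝔣z) = (2C_kW(χ̄)/𝔣^k) E_k^{𝟙,χ}(z)`, `E_k^{𝟙,χ} = -B_{k,χ}/2k + ∑ σ_{k-1}^{𝟙,χ}(n)qⁿ`,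
  from Miyake Thm. 7.1.3 / (7.1.13)); Diamond–Shurman Thm. 4.5.1;
* `qExpansion_coeff_eisensteinCharMF` — the coefficients of Mathlib's `qExpansion 1` of the
  modular form `eisensteinCharMF N k ψ⁻¹ ∈ M_k(Γ₁(N))`: `a₀ = 2`,
  `aₙ = (2(-2πi)^k W(ψ)/(N^k(k-1)! L(k,ψ))) σ_{k-1}^{ψ̄}(n)` (`ModularFormClass.qExpansion_coeff_unique`).

So `E_k^{ψ̄}/2 = 1 + (C_k W(ψ)/(N^k L(k,ψ))) ∑ σ_{k-1}^{ψ̄}(n) qⁿ` is the normalised Eisenstein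
series of type `(k, ψ̄)` at `∞` up to the constant `-4k/B_{k,ψ̄}`-type factor; the identification
`N^k L(k,ψ)/(C_k W(ψ)) = -B_{k,ψ̄}/2k` (functional equation; Billerey–Menares (7.1.13) as printed,
with the constant term `-δ(χ₁)B_{k,χ₂}/2k` of (7.1.3)) is deliberately NOT here, nor are weights
`1, 2`, imprimitive characters, or the constant terms at the other cusps (op. cit. Prop. 4).

## References

* N. Billerey, R. Menares, *Strong modularity of reducible Galois representations*, Trans. AMS 370
  (2018), §1.3, (7.1.3) and (7.1.13). [BillereyMenares2018]
* T. Miyake, *Modular Forms*, Springer (2006), Thm. 7.1.3, (7.1.13). [Miyake2006]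
* F. Diamond, J. Shurman, *A First Course in Modular Forms*, GTM 228 (2005), §4.5–4.6, Thm. 4.5.1,
  Thm. 4.6.2. [DiamondShurman2005]
-/

noncomputable section

open Complex UpperHalfPlane EisensteinSeries Filter Finset ModularForm
open scoped Real

namespace Literature.NumberTheory.EllipticCurves.ModularForms

/-! ### The lattice sum is `L(k, ψ)` times the sum over coprime pairs -/

section Gcd

variable {N : ℕ} [NeZero N] (k : ℕ) (ψ : DirichletCharacter ℂ N) (z : ℍ)

omit [NeZero N] in
/-- Homogeneity of the summand: `ψ(r d) (N r c z + r d)^{-k} = ψ(r) r^{-k} · ψ(d) (Ncz + d)^{-k}`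
(`r = 0` included: both sides vanish for `k ≠ 0`). [folklore] -/
theorem latticeSummand_nsmul (hk : k ≠ 0) (r : ℕ) (w : Fin 2 → ℤ) :
    ψ ((r • w) 1) * eisSummand k ![(N : ℤ) * (r • w) 0, (r • w) 1] z =
      ψ r * ((r : ℂ) ^ k)⁻¹ * (ψ (w 1) * eisSummand k ![(N : ℤ) * w 0, w 1] z) := by
  simp only [Pi.smul_apply, nsmul_eq_mul, eisSummand, Matrix.cons_val_zero, Matrix.cons_val_one,
    Matrix.cons_val_fin_one]
  push_cast
  rw [map_mul]
  rcases eq_or_ne r 0 with rfl | hr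
  · simp [zero_pow hk, zero_zpow _ (show (-(k : ℤ)) ≠ 0 by omega)]
  · have h : ((N : ℂ) * ((r : ℂ) * (w 0 : ℂ)) * (z : ℂ) + (r : ℂ) * (w 1 : ℂ)) =
        (r : ℂ) * ((N : ℂ) * w 0 * z + w 1) := by ring
    rw [h, mul_zpow, zpow_neg (r : ℂ), zpow_natCast]
    ring

/-- **`G_ψ = L(k, ψ) · ∑_{(c,d) coprime} ψ(d) (Ncz + d)^{-k}`** (`k ≥ 3`): decompose `ℤ²` by the
gcd `r` of `(c, d)` (Mathlib `gammaSetDivGcdSigmaEquiv`), use homogeneity and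
`∑_r ψ(r) r^{-k} = L(k, ψ)`.  (Level-one analogue: Mathlib
`tsum_eisSummand_eq_riemannZeta_mul_eisensteinSeries`.) [cite: DiamondShurman2005, §4.5 (proof of Thm. 4.5.1)] -/
theorem eisLatticeChar_eq_LFunction_mul_tsum_coprime (hk : 3 ≤ k) :
    ∑' v : Fin 2 → ℤ, ψ (v 1) * eisSummand k ![(N : ℤ) * v 0, v 1] z =
      ψ.LFunction k *
        ∑' w : gammaSet 1 1 0, ψ (w.1 1) * eisSummand k ![(N : ℤ) * w.1 0, w.1 1] z := by
  set f : (Fin 2 → ℤ) → ℂ := fun v ↦ ψ (v 1) * eisSummand k ![(N : ℤ) * v 0, v 1] z with hf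
  have hfs : Summable f := summable_eisLatticeChar k ψ z hk
  have hfs' : Summable fun x : (Σ r : ℕ, gammaSet 1 r 0) ↦ f x.2 := by
    have := gammaSetDivGcdSigmaEquiv.symm.summable_iff.mpr hfs
    simpa [Function.comp_def] using this
  have hr : ∀ r : ℕ, ∑' v : gammaSet 1 r 0, f v =
      ψ r * ((r : ℂ) ^ k)⁻¹ * ∑' w : gammaSet 1 1 0, f w := by
    intro r
    have h1 : ∀ v : gammaSet 1 r 0, f v = ψ r * ((r : ℂ) ^ k)⁻¹ * f (divIntMap r v.1) := by
      intro v
      conv_lhs => rw [gammaSet_eq_gcd_mul_divIntMap v.2]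
      exact latticeSummand_nsmul k ψ z (by omega) r _
    rw [tsum_congr h1, tsum_mul_left]
    rcases eq_or_ne r 0 with rfl | hr0
    · simp [zero_pow (show k ≠ 0 by omega)]
    · haveI : NeZero r := ⟨hr0⟩
      congr 1
      exact (gammaSetDivGcdEquiv r).tsum_eq (fun w : gammaSet 1 1 0 ↦ f w)
  have hL : ∑' r : ℕ, ψ r * ((r : ℂ) ^ k)⁻¹ = ψ.LFunction k := by
    have hre : 1 < ((k : ℂ)).re := by simp; omega
    rw [DirichletCharacter.LFunction_eq_LSeries ψ hre, LSeries]
    refine tsum_congr fun r ↦ ?_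
    rcases eq_or_ne r 0 with rfl | hr0
    · simp [zero_pow (show k ≠ 0 by omega)]
    · rw [LSeries.term_of_ne_zero hr0, Complex.cpow_natCast, div_eq_mul_inv]
  calc ∑' v, f v = ∑' x : (Σ r : ℕ, gammaSet 1 r 0), f x.2 := by
        rw [← gammaSetDivGcdSigmaEquiv.symm.tsum_eq]
        rfl
    _ = ∑' (r : ℕ) (v : gammaSet 1 r 0), f v := hfs'.tsum_sigma
    _ = ∑' r : ℕ, ψ r * ((r : ℂ) ^ k)⁻¹ * ∑' w : gammaSet 1 1 0, f w := tsum_congr hr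
    _ = _ := by rw [tsum_mul_right, hL]

end Gcd

/-! ### The sum over coprime pairs is `E_k^{ψ̄} = ∑_u ψ(u) E_{k,(0,u)}` -/

section Coprime

variable {N : ℕ} [NeZero N] (k : ℕ) (ψ : DirichletCharacter ℂ N) (z : ℍ)

omit [NeZero N] in
/-- The sets `gammaSet N 1 (0, u)`, `u ∈ (ℤ/Nℤ)ˣ`, are pairwise disjoint. [folklore] -/
theorem pairwise_disjoint_gammaSet_units :
    Pairwise (Function.onFun Disjoint fun u : (ZMod N)ˣ ↦ gammaSet N 1 ![0, (u : ZMod N)]) := by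
  intro u v huv
  refine pairwise_disjoint_gammaSet (N := N) (r := 1) fun h ↦ huv ?_
  have := congr_fun h 1
  simp only [Matrix.cons_val_one, Matrix.cons_val_fin_one] at this
  exact Units.ext this

omit [NeZero N] in
/-- A unit `d̄ ∈ (ℤ/Nℤ)ˣ` comes from an integer `d` prime to `N`. [folklore] -/
theorem isCoprime_of_isUnit_intCast {d : ℤ} (hu : IsUnit ((d : ℤ) : ZMod N)) :
    IsCoprime d (N : ℤ) := by
  obtain ⟨u, hu⟩ := hu
  obtain ⟨e, he⟩ : ∃ e : ℤ, ((e : ℤ) : ZMod N) = ((u⁻¹ : (ZMod N)ˣ) : ZMod N) :=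
    ZMod.intCast_surjective _
  have h1 : (((d * e - 1 : ℤ)) : ZMod N) = 0 := by
    push_cast
    rw [← hu, he, Units.mul_inv, sub_self]
  obtain ⟨t, ht⟩ := (ZMod.intCast_zmod_eq_zero_iff_dvd _ N).mp h1
  exact ⟨e, -t, by linear_combination ht⟩

omit [NeZero N] in
/-- A coprime pair `(c, d)` with `d` a unit modulo `N` gives `(Nc, d) ∈ gammaSet N 1 (0, d̄)`.
[folklore] -/
theorem scaleFst_mem_gammaSet {w : Fin 2 → ℤ} (hw : w ∈ gammaSet 1 1 0)
    (hu : IsUnit ((w 1 : ℤ) : ZMod N)) :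
    (![(N : ℤ) * w 0, w 1] : Fin 2 → ℤ) ∈ gammaSet N 1 ![0, ((w 1 : ℤ) : ZMod N)] := by
  refine ⟨?_, ?_⟩
  · funext i
    fin_cases i <;> simp
  · simp only [Matrix.cons_val_zero, Matrix.cons_val_one, Matrix.cons_val_fin_one]
    rw [mem_gammaSet_one] at hw
    rw [← Int.isCoprime_iff_gcd_eq_one]
    exact IsCoprime.mul_left (isCoprime_of_isUnit_intCast hu).symm hw

/-- **`∑_{(c,d) coprime} ψ(d) (Ncz + d)^{-k} = E_k^{ψ̄}(z) = ∑_{u ∈ (ℤ/Nℤ)ˣ} ψ(u) E_{k,(0,u)}(z)`**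
(`eisensteinChar N k ψ⁻¹` of `EisensteinSeriesNebentypus`): the pairs with `d` a non-unit
modulo `N` contribute `0`, and `(c, d) ↦ (Nc, d)` is a bijection from the coprime pairs with
`d ≡ u` onto `gammaSet N 1 (0, u)`. [cite: DiamondShurman2005, §4.5–4.6 (the series `G_k^{v̄}` and `E_k^{ψ,φ}`)] -/
theorem tsum_coprime_eq_eisensteinChar (hk : 3 ≤ k) :
    ∑' w : gammaSet 1 1 0, ψ (w.1 1) * eisSummand k ![(N : ℤ) * w.1 0, w.1 1] z =
      eisensteinChar N k ψ⁻¹ z := by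
  set ι : (Fin 2 → ℤ) → (Fin 2 → ℤ) := fun v ↦ ![(N : ℤ) * v 0, v 1] with hι
  set h : (Fin 2 → ℤ) → ℂ := fun x ↦ ψ (x 1) * eisSummand k x z with hh
  have hS : Summable h := by
    refine Summable.of_norm_bounded (summable_norm_eisSummand (k := k) (by exact_mod_cast hk) z)
      fun x ↦ ?_
    rw [hh, norm_mul]
    exact mul_le_of_le_one_left (norm_nonneg _) (ψ.norm_le_one _)
  set S : Set (Fin 2 → ℤ) := ι '' gammaSet 1 1 0 with hSdef
  set T : (ZMod N)ˣ → Set (Fin 2 → ℤ) := fun u ↦ gammaSet N 1 ![0, (u : ZMod N)] with hT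
  set U : Set (Fin 2 → ℤ) := ⋃ u, T u with hU
  -- (1) the left-hand side as a sum over `S`
  have h1 : ∑' w : gammaSet 1 1 0, ψ (w.1 1) * eisSummand k ![(N : ℤ) * w.1 0, w.1 1] z =
      ∑' x : S, h x := by
    rw [hSdef, tsum_image h (scaleFst_injective (N := N)).injOn]
    refine tsum_congr fun w ↦ ?_
    simp [hh]
  -- (2) `U ⊆ S` and the indicators of `h` on `S` and `U` agree
  have hUS : U ⊆ S := by
    intro x hx
    obtain ⟨u, hxu⟩ := Set.mem_iUnion.mp hx
    obtain ⟨hres, hgcd⟩ := hxu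
    have h0 : ((x 0 : ℤ) : ZMod N) = 0 := by simpa using congr_fun hres 0
    obtain ⟨c, hc⟩ := (ZMod.intCast_zmod_eq_zero_iff_dvd _ N).mp h0
    refine ⟨![c, x 1], ?_, ?_⟩
    · rw [mem_gammaSet_one]
      simp only [Matrix.cons_val_zero, Matrix.cons_val_one, Matrix.cons_val_fin_one]
      have : IsCoprime (x 0) (x 1) := Int.isCoprime_iff_gcd_eq_one.mpr hgcd
      rw [hc] at this
      exact this.of_mul_left_right
    · funext i
      fin_cases i <;> simp [hι, hc]
  have hind : S.indicator h = U.indicator h := by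
    funext x
    by_cases hxU : x ∈ U
    · rw [Set.indicator_of_mem hxU, Set.indicator_of_mem (hUS hxU)]
    · rw [Set.indicator_of_notMem hxU]
      by_cases hxS : x ∈ S
      · rw [Set.indicator_of_mem hxS, hh]
        dsimp only
        have hnu : ¬ IsUnit ((x 1 : ℤ) : ZMod N) := by
          intro hu
          apply hxU
          obtain ⟨w, hw, rfl⟩ := hxS
          refine Set.mem_iUnion.mpr ⟨hu.unit, ?_⟩
          have hu' : IsUnit ((w 1 : ℤ) : ZMod N) := by simpa [hι] using hu
          have := scaleFst_mem_gammaSet (N := N) hw hu'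
          simpa [hT, hι, IsUnit.unit_spec] using this
        rw [ψ.map_nonunit hnu, zero_mul]
      · rw [Set.indicator_of_notMem hxS]
  -- (3) `∑_{x ∈ S} h = ∑_{x ∈ U} h`
  have h3 : ∑' x : S, h x = ∑' x : U, h x := by
    rw [_root_.tsum_subtype, hind, ← _root_.tsum_subtype]
  -- (4) `∑_{x ∈ U} h = ∑_u ∑_{x ∈ T u} h`
  have hdisj : Pairwise (Function.onFun Disjoint T) := pairwise_disjoint_gammaSet_units
  have h4 : ∑' x : U, h x = ∑ u : (ZMod N)ˣ, ∑' x : T u, h x := by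
    rw [← (Set.unionEqSigmaOfDisjoint hdisj).symm.tsum_eq]
    simp only [Set.coe_unionEqSigmaOfDisjoint_symm_apply]
    have hs4 : Summable fun p : (Σ u : (ZMod N)ˣ, T u) ↦ h p.2 := by
      have := (Set.unionEqSigmaOfDisjoint hdisj).symm.summable_iff.mpr (hS.subtype U)
      simpa [Function.comp_def] using this
    rw [hs4.tsum_sigma, tsum_fintype]
  -- (5) each fibre
  have h5 : ∀ u : (ZMod N)ˣ, ∑' x : T u, h x = ψ u * eisensteinSeries ![0, (u : ZMod N)] k z := by
    intro u
    simp only [eisensteinSeries, ← tsum_mul_left]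
    refine tsum_congr fun x ↦ ?_
    rw [hh]
    dsimp only
    congr 1
    have := congr_fun x.2.1 1
    simp only [Function.comp_apply, Matrix.cons_val_one, Matrix.cons_val_fin_one] at this
    rw [this]
  rw [h1, h3, h4]
  simp only [eisensteinChar]
  refine Finset.sum_congr rfl fun u _ ↦ ?_
  rw [h5, MulChar.inv_apply, Ring.inverse_unit, inv_inv]

/-- **`G_ψ = L(k, ψ) · E_k^{ψ̄}`**: the Eisenstein lattice sum with character is `L(k, ψ)` times the
Eisenstein series with nebentypus `eisensteinChar N k ψ⁻¹ = ∑_u ψ(u) E_{k,(0,u)}` of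
`EisensteinSeriesNebentypus` (`k ≥ 3`). [cite: DiamondShurman2005, §4.5–4.6] -/
theorem eisLatticeChar_eq_LFunction_mul_eisensteinChar (hk : 3 ≤ k) :
    ∑' v : Fin 2 → ℤ, ψ (v 1) * eisSummand k ![(N : ℤ) * v 0, v 1] z =
      ψ.LFunction k * eisensteinChar N k ψ⁻¹ z := by
  rw [eisLatticeChar_eq_LFunction_mul_tsum_coprime k ψ z hk, tsum_coprime_eq_eisensteinChar k ψ z hk]

end Coprime

/-! ### The `q`-expansion of `E_k^{ψ̄}` and of the modular form `eisensteinCharMF` -/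

section QExpansionMF

variable {N : ℕ} [NeZero N] (k : ℕ) (ψ : DirichletCharacter ℂ N)

/-- `L(k, ψ) ≠ 0` for an integer `k ≥ 2` (Mathlib: non-vanishing on `Re s ≥ 1`). [folklore] -/
theorem LFunction_natCast_ne_zero (hk : 2 ≤ k) : ψ.LFunction k ≠ 0 :=
  DirichletCharacter.LFunction_ne_zero_of_one_le_re ψ
    (Or.inr (by exact_mod_cast (show k ≠ 1 by omega))) (by simp; omega)

/-- Summability of `∑_n σ_{k}^{w}(n) rⁿ` for `‖r‖ < 1` and a weight `|w| ≤ 1`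
(comparison with `∑ n^{k+1} rⁿ`). [folklore] -/
theorem summable_divisorSum_mul_pow (k : ℕ) {r : ℂ} (hr : ‖r‖ < 1) (w : ℕ → ℂ)
    (hw : ∀ d, ‖w d‖ ≤ 1) :
    Summable fun n : ℕ ↦ (∑ d ∈ n.divisors, w d * (d : ℂ) ^ k) * r ^ n := by
  refine Summable.of_norm_bounded (summable_norm_pow_mul_geometric_of_norm_lt_one (k + 1) hr)
    fun n ↦ ?_
  rw [norm_mul, norm_mul, norm_pow, norm_pow, Complex.norm_natCast]
  refine mul_le_mul_of_nonneg_right ?_ (by positivity)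
  calc ‖∑ d ∈ n.divisors, w d * (d : ℂ) ^ k‖ ≤ ∑ d ∈ n.divisors, (d : ℝ) ^ k := by
        refine (norm_sum_le _ _).trans (Finset.sum_le_sum fun d _ ↦ ?_)
        rw [norm_mul, norm_pow, Complex.norm_natCast]
        exact mul_le_of_le_one_left (by positivity) (hw _)
    _ ≤ ∑ _d ∈ n.divisors, (n : ℝ) ^ k := Finset.sum_le_sum fun d hd ↦ by
        gcongr
        exact Nat.divisor_le hd
    _ ≤ (n : ℝ) ^ (k + 1) := by
        rw [Finset.sum_const, nsmul_eq_mul, pow_succ']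
        gcongr
        exact_mod_cast Nat.card_divisors_le_self n

/-- **The `q`-expansion of the Eisenstein series with nebentypus `E_k^{ψ̄} = ∑_u ψ(u) E_{k,(0,u)}`**
(Billerey–Menares 2018, (7.1.13): `G_k^{𝟙,χ}(𝔣 z) = (2 C_k W(χ̄)/𝔣^k) E_k^{𝟙,χ}(z)`; Miyake
Thm. 7.1.3; Diamond–Shurman Thm. 4.5.1), for a PRIMITIVE `ψ` modulo `N` with `ψ(-1) = (-1)^k`,
`k ≥ 3`:

  `E_k^{ψ̄}(z) = 2 + (2 (-2πi)^k W(ψ) / (N^k (k-1)! L(k, ψ))) ∑_{n ≥ 1} σ_{k-1}^{ψ̄}(n) qⁿ`.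

(The constant `2` is `1 + ψ̄(-1)(-1)^k`, cf. `tendsto_eisensteinChar_atImInfty`.)
[cite: BillereyMenares2018, §1.3 (7.1.13)] -/
theorem eisensteinChar_eq_qExpansion (hk : 3 ≤ k) (hψ : ψ.IsPrimitive)
    (hpar : ψ (-1) = (-1) ^ k) (z : ℍ) :
    eisensteinChar N k ψ⁻¹ z = 2 +
      2 * (((N : ℂ) ^ k)⁻¹ * ((-2 * π * Complex.I) ^ k / (k - 1).factorial) *
          gaussSum ψ (ZMod.stdAddChar (N := N))) / ψ.LFunction k *
        ∑' n : ℕ+, (∑ d ∈ (n : ℕ).divisors, ψ⁻¹ d * (d : ℂ) ^ (k - 1)) *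
          cexp (2 * π * Complex.I * z) ^ (n : ℕ) := by
  have hL := LFunction_natCast_ne_zero k ψ (by omega)
  have h1 := eisLatticeChar_eq_LFunction_mul_eisensteinChar k ψ z hk
  rw [eisLatticeChar_eq_qExpansion k ψ z hk hψ hpar] at h1
  apply mul_left_cancel₀ hL
  rw [← h1]
  field_simp

/-- **The `q`-expansion coefficients of the modular form `E_k^{ψ̄} ∈ M_k(Γ₁(N))`**
(`eisensteinCharMF N k ψ⁻¹`, weight `k ≥ 3`, `ψ` primitive, `ψ(-1) = (-1)^k`): `a₀ = 2` and
`aₙ = (2 (-2πi)^k W(ψ) / (N^k (k-1)! L(k,ψ))) σ_{k-1}^{ψ̄}(n)` for `n ≥ 1` (Mathlib's `qExpansion 1`,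
uniqueness of `q`-expansions `ModularFormClass.qExpansion_coeff_unique`).
[cite: BillereyMenares2018, §1.3 (7.1.13) with (7.1.3)] -/
theorem qExpansion_coeff_eisensteinCharMF (hk : 3 ≤ k) (hψ : ψ.IsPrimitive)
    (hpar : ψ (-1) = (-1) ^ k) (n : ℕ) :
    (qExpansion 1 ⇑(eisensteinCharMF N k ψ⁻¹ (by exact_mod_cast hk))).coeff n =
      if n = 0 then 2 else
        2 * (((N : ℂ) ^ k)⁻¹ * ((-2 * π * Complex.I) ^ k / (k - 1).factorial) *
            gaussSum ψ (ZMod.stdAddChar (N := N))) / ψ.LFunction k *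
          ∑ d ∈ n.divisors, ψ⁻¹ d * (d : ℂ) ^ (k - 1) := by
  set β : ℂ := 2 * (((N : ℂ) ^ k)⁻¹ * ((-2 * π * Complex.I) ^ k / (k - 1).factorial) *
    gaussSum ψ (ZMod.stdAddChar (N := N))) / ψ.LFunction k with hβ
  set c : ℕ → ℂ := fun m ↦ if m = 0 then 2 else β * ∑ d ∈ m.divisors, ψ⁻¹ d * (d : ℂ) ^ (k - 1)
    with hc
  suffices h : ∀ τ : ℍ, HasSum (fun m ↦ c m • Function.Periodic.qParam (1 : ℝ) τ ^ m)
      (eisensteinCharMF N k ψ⁻¹ (by exact_mod_cast hk) τ) from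
    (ModularFormClass.qExpansion_coeff_unique one_pos (by simp) h n).symm
  intro τ
  change HasSum (fun m ↦ c m * Function.Periodic.qParam (1 : ℝ) τ ^ m)
    (eisensteinCharMF N k ψ⁻¹ (by exact_mod_cast hk) τ)
  have hq : ‖cexp (2 * π * Complex.I * τ)‖ < 1 := norm_exp_two_pi_I_lt_one τ
  have hS : Summable fun m : ℕ ↦ (∑ d ∈ (m + 1).divisors, ψ⁻¹ d * (d : ℂ) ^ (k - 1)) *
      cexp (2 * π * Complex.I * τ) ^ (m + 1) :=
    (summable_nat_add_iff 1).mpr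
      (summable_divisorSum_mul_pow (k - 1) hq (fun d ↦ ψ⁻¹ d) fun d ↦ ψ⁻¹.norm_le_one _)
  rw [← hasSum_nat_add_iff' 1]
  simp only [Nat.add_eq_zero_iff, one_ne_zero, and_false, ↓reduceIte, Finset.range_one,
    Finset.sum_singleton, pow_zero, mul_one, c, Function.Periodic.qParam, Complex.ofReal_one,
    div_one]
  have hval : eisensteinCharMF N k ψ⁻¹ (by exact_mod_cast hk) τ - 2 =
      β * ∑' m : ℕ, (∑ d ∈ (m + 1).divisors, ψ⁻¹ d * (d : ℂ) ^ (k - 1)) *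
        cexp (2 * π * Complex.I * τ) ^ (m + 1) := by
    rw [coe_eisensteinCharMF, eisensteinChar_eq_qExpansion k ψ hk hψ hpar τ, ← hβ,
      tsum_pnat_eq_tsum_succ (f := fun m : ℕ ↦ (∑ d ∈ m.divisors, ψ⁻¹ d * (d : ℂ) ^ (k - 1)) *
        cexp (2 * π * Complex.I * τ) ^ m)]
    ring
  rw [hval]
  have h := hS.hasSum.mul_left β
  simp only [← mul_assoc] at h
  exact h

end QExpansionMF

end Literature.NumberTheory.EllipticCurves.ModularForms
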